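import Mathlib

/-!
# Stub `stub_repairLipschitz` — crux stmt-PneNP-2463 (`SolvableImpliesStableSection`), line `Sketch`

Block "one round of local repair": the repair map is `2`-Lipschitz under single-literal changes.
Instances are `Φ : Fin m → Fin k → Fin n × Bool` (`m` clauses of `k` literals, a literal being a pair
(variable, sign)).  If `g Φ v` says "`v` is the first variable of some all-positive clause of `Φ`", then
replacing the literal at position `(a, b)` by `ℓ` changes `g` only at the old and the new first variable
of clause `a`, hence in at most two coordinates.
-/

set_option linter.dupNamespace false

namespace Summit.PneNP.PneNP.Cruxes.SolvableImpliesStableSection.Sketch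

open Finset
open scoped Classical

/-- **The repair map is `2`-Lipschitz.** If `g Φ v` says "`v` is the first variable of some
all-positive clause of `Φ`", then a single-literal change moves `g` in at most two coordinates (the old and
the new first variable of the modified clause). -/
theorem stub_repairLipschitz (k m n : ℕ) (hk : 0 < k)
    (g : (Fin m → Fin k → Fin n × Bool) → (Fin n → Bool))
    (hg : ∀ (Φ : Fin m → Fin k → Fin n × Bool) (v : Fin n),
      g Φ v = true ↔ ∃ a : Fin m, (Φ a ⟨0, hk⟩).1 = v ∧ ∀ j, (Φ a j).2 = true)
    (Φ : Fin m → Fin k → Fin n × Bool) (a : Fin m) (b : Fin k) (ℓ : Fin n × Bool) :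
    (hammingDist (g Φ) (g (Function.update Φ a (Function.update (Φ a) b ℓ))) : ℝ) ≤ 2 := by
  set Φ' := Function.update Φ a (Function.update (Φ a) b ℓ) with hΦ'
  -- every clause other than `a` is unchanged
  have hne : ∀ a' : Fin m, a' ≠ a → Φ' a' = Φ a' := fun a' h => Function.update_of_ne h _ Φ
  -- outside the old and the new first variable of clause `a`, `g` does not move
  have key : ∀ v : Fin n, v ≠ (Φ a ⟨0, hk⟩).1 → v ≠ (Φ' a ⟨0, hk⟩).1 → g Φ v = g Φ' v := by
    intro v hv hv'
    rw [Bool.eq_iff_iff, hg, hg]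
    constructor
    · rintro ⟨a', ha', hall⟩
      have ha'a : a' ≠ a := by
        rintro rfl
        exact hv ha'.symm
      exact ⟨a', by rw [hne a' ha'a]; exact ha', by rw [hne a' ha'a]; exact hall⟩
    · rintro ⟨a', ha', hall⟩
      have ha'a : a' ≠ a := by
        rintro rfl
        exact hv' ha'.symm
      exact ⟨a', by rw [← hne a' ha'a]; exact ha', by rw [← hne a' ha'a]; exact hall⟩
  -- hence the mismatch set sits inside a pair
  have hcard : hammingDist (g Φ) (g Φ') ≤ 2 := by
    unfold hammingDist
    refine le_trans (Finset.card_le_card (t := {(Φ a ⟨0, hk⟩).1, (Φ' a ⟨0, hk⟩).1}) ?_)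
      Finset.card_le_two
    intro v hv
    rw [Finset.mem_filter] at hv
    rw [Finset.mem_insert, Finset.mem_singleton]
    by_contra h
    rw [not_or] at h
    exact hv.2 (key v h.1 h.2)
  exact_mod_cast hcard

end Summit.PneNP.PneNP.Cruxes.SolvableImpliesStableSection.Sketch
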